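import Mathlib
import HarnessLib
import Summits.KontsevichZagierPeriods.Zeta5Search.Denom.CatalanQBridgeProof
import Summits.KontsevichZagierPeriods.Zeta5Search.Denom.CatalanRayPClosed

/-!
# The slid `ξ`-coefficient IS the tree's `catalanQ` — input (L4) of the 2-adic ray chain, proved

HONEST FRAMING: systematic search; no irrationality claim unless certified.  Pure finite algebra of factorials;
nothing here concerns the irrationality of `G` (or of `ξ`).

fam-catalan (pub-zeta5), `families/catalan/TWOADIC.md` §12.  The partial-fraction (slid) representation of the
2-adic Catalan box form `J₂(n, J, n, J+n, n)` (`CatalanTwoAdicPF`) produces, as the coefficient of `ξ`, the finite sum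

  `Qxi(n, J) = Σ_{c=0}^{J−n} coef(c) · 8·C(2c,c)/4^c − 8 · Σ_{a=1}^{n} coef(−a) · t_{a−1}`

over fam-denom's pole coefficients `coef = Denom.CatalanRayPClosed.coef` (`t_{a−1} = Denom.CatalanRayPClosed.tB a`).
THIS FILE PROVES `Qxi(n, J) = QClosed n J n (J+n) n` (`Denom.CatalanBox.QClosed`, fam-denom's kernel formula for the
`G`-coefficient, `= catalanQ` by `catalanQ_eq_QClosed`) for all `n ≤ J` — hence on every ray `J = jn`, `j ≥ 1`:
`qxiSum_ray_eq_catalanQ`.  The identity holds TERMWISE after the reindexing `c ↦ i = J − n − c` (c-terms) and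
`a ↦ i = J − n + a` (a-terms) of `QClosed = Σ_{i ≤ J} qTerm(i)`: each of `cTerm_eq`, `aTerm_eq` is a closed
factorial identity once the pieces of `coef` are written out —

* `K0_eq : (½)_n = (2n)!/(4^n n!)`;
* `Nnum_nat`, `Nnum_neg`: the numerator `N(d) = Π_{i<J+n}(d − J + ½ + i)` at `d = c ≥ 0` / `d = −a` is the tree's
  `oddProd` (the same `J` odd factors as in `qTerm`'s `F₁`) times an odd run `(2c+1)(2c+3)⋯` / `(−1)^a(2a−1)!!(2B−1)!!`;
* `D1_nat`, `D1_neg`, `D2_nat`, `D2_neg`: the PUNCTURED denominators (`skip` replaces the pole's own zero factor by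
  `1`) are `(−1)^A · A! · B!` — the window lemma `prod_skip_window : Π_{i<A+B+1} skip(i − A) = (−1)^A A! B!`.

These closed forms are also what a bound `|coef n J d| ≤ poly · C(J+n, n)` (fam-denom's input for (T-G)) starts from.
-/

namespace Summit.KontsevichZagierPeriods.Zeta5Search.CatalanTwoAdicSeries

open Finset
open Summit.KontsevichZagierPeriods.Zeta5Search.KernelKit (binomF binomF_eq)
open Summit.KontsevichZagierPeriods.Zeta5Search.Denom.CatalanBox
  (superCatalan oddProd F1 qTerm qSum QClosed qSum_eq_sum catalanQ_eq_QClosed)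
open Summit.KontsevichZagierPeriods.Zeta5Search.Denom.CatalanRayPClosed (K0 Nnum skip D1 D2 coef)
open Summit.KontsevichZagierPeriods.Zeta5Search.CatalanQSum (catalanQ)

/-! ### Factorial bookkeeping -/

/-- `∏_{i<N} (i + 1) = N!` in `ℚ`. -/
theorem prod_range_add_one_cast (N : ℕ) : ∏ i ∈ range N, ((i : ℚ) + 1) = (N.factorial : ℚ) := by
  have h := congrArg (Nat.cast : ℕ → ℚ) (Finset.prod_range_add_one_eq_factorial N)
  push_cast at h
  exact h

/-- The punctured product over a window of consecutive integers through zero (fam-denom's `skip` replaces the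
zero factor by `1`): `∏_{i<A+B+1} skip(i − A) = (−1)^A · A! · B!`. -/
theorem prod_skip_window (A B : ℕ) :
    ∏ i ∈ range (A + B + 1), skip ((i : ℚ) - A) = (-1) ^ A * (A.factorial : ℚ) * (B.factorial : ℚ) := by
  rw [show A + B + 1 = A + (B + 1) by ring, Finset.prod_range_add, Finset.prod_range_succ']
  have h1 : ∏ i ∈ range A, skip ((i : ℚ) - A) = (-1) ^ A * (A.factorial : ℚ) := by
    have hr : ∀ i ∈ range A, skip ((i : ℚ) - A) = -((((A - 1 - i : ℕ)) : ℚ) + 1) := by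
      intro i hi
      rw [Finset.mem_range] at hi
      have hlt : (i : ℚ) < A := by exact_mod_cast hi
      rw [skip, if_neg (by linarith), Nat.sub_sub, Nat.cast_sub (by omega : 1 + i ≤ A)]
      push_cast
      ring
    rw [Finset.prod_congr rfl hr, Finset.prod_range_reflect (fun k => -((k : ℚ) + 1)) A, Finset.prod_neg,
      Finset.card_range, prod_range_add_one_cast]
  have h2 : ∏ k ∈ range B, skip (((A + (k + 1) : ℕ) : ℚ) - A) = (B.factorial : ℚ) := by
    have hr : ∀ k ∈ range B, skip (((A + (k + 1) : ℕ) : ℚ) - A) = (k : ℚ) + 1 := by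
      intro k _
      have hk : (((A + (k + 1) : ℕ) : ℚ) - A) = (k : ℚ) + 1 := by push_cast; ring
      rw [hk, skip, if_neg (by positivity)]
    rw [Finset.prod_congr rfl hr, prod_range_add_one_cast]
  have h3 : skip (((A + 0 : ℕ) : ℚ) - A) = 1 := by rw [skip, if_pos (by push_cast; ring)]
  rw [h1, h2, h3]
  ring

/-- The odd run above `2c`: `∏_{i<n} (2c + 2i + 1) = (2c+2n)!·c! / ((2c)!·(c+n)!·2^n)`. -/
theorem prod_odd_run (c n : ℕ) :
    ∏ i ∈ range n, (2 * (c : ℚ) + 2 * i + 1)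
      = ((2 * c + 2 * n).factorial : ℚ) * (c.factorial : ℚ)
          / (((2 * c).factorial : ℚ) * ((c + n).factorial : ℚ) * 2 ^ n) := by
  induction n with
  | zero =>
    have h1 : ((2 * c).factorial : ℚ) ≠ 0 := by positivity
    have h2 : (c.factorial : ℚ) ≠ 0 := by positivity
    simp only [Finset.range_zero, Finset.prod_empty, mul_zero, add_zero, pow_zero, mul_one]
    field_simp
  | succ n ih =>
    rw [Finset.prod_range_succ, ih, show 2 * c + 2 * (n + 1) = (2 * c + 2 * n + 1) + 1 by ring, Nat.factorial_succ,
      Nat.factorial_succ (2 * c + 2 * n), show c + (n + 1) = (c + n) + 1 by ring, Nat.factorial_succ (c + n)]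
    have h1 : ((2 * c).factorial : ℚ) ≠ 0 := by positivity
    have h2 : ((c + n).factorial : ℚ) ≠ 0 := by positivity
    push_cast
    field_simp
    ring

/-- The odd run `(2m−1)!! = ∏_{i<m} (2i + 1) = (2m)!/(2^m m!)`. -/
theorem prod_odd_run_zero (m : ℕ) :
    ∏ i ∈ range m, (2 * (i : ℚ) + 1) = ((2 * m).factorial : ℚ) / (2 ^ m * (m.factorial : ℚ)) := by
  have h := prod_odd_run 0 m
  simp only [Nat.cast_zero, mul_zero, zero_add, Nat.factorial_zero, Nat.cast_one, mul_one, one_mul] at h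
  rw [h]
  ring

/-- The odd run through zero: `∏_{i<a+m} (2i − 2a + 1) = (−1)^a (2a−1)!! (2m−1)!!`. -/
theorem prod_odd_neg_run (a m : ℕ) :
    ∏ i ∈ range (a + m), (2 * (i : ℚ) - 2 * a + 1)
      = (-1) ^ a * (((2 * a).factorial : ℚ) / (2 ^ a * (a.factorial : ℚ)))
          * (((2 * m).factorial : ℚ) / (2 ^ m * (m.factorial : ℚ))) := by
  rw [Finset.prod_range_add]
  have h1 : ∏ i ∈ range a, (2 * (i : ℚ) - 2 * a + 1)
      = (-1) ^ a * (((2 * a).factorial : ℚ) / (2 ^ a * (a.factorial : ℚ))) := by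
    have hr : ∀ i ∈ range a, (2 * (i : ℚ) - 2 * a + 1) = -(2 * (((a - 1 - i : ℕ)) : ℚ) + 1) := by
      intro i hi
      rw [Finset.mem_range] at hi
      rw [Nat.sub_sub, Nat.cast_sub (by omega : 1 + i ≤ a)]
      push_cast
      ring
    rw [Finset.prod_congr rfl hr, Finset.prod_range_reflect (fun k => -(2 * (k : ℚ) + 1)) a, Finset.prod_neg,
      Finset.card_range, prod_odd_run_zero]
  have h2 : ∏ i ∈ range m, (2 * (((a + i : ℕ)) : ℚ) - 2 * a + 1)
      = ((2 * m).factorial : ℚ) / (2 ^ m * (m.factorial : ℚ)) := by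
    have hr : ∀ i ∈ range m, (2 * (((a + i : ℕ)) : ℚ) - 2 * a + 1) = 2 * (i : ℚ) + 1 := by
      intro i _; push_cast; ring
    rw [Finset.prod_congr rfl hr, prod_odd_run_zero]
  rw [h1, h2]

/-- The tree's `oddProd` (an `ℤ`-recursion) as a product in `ℚ`. -/
theorem oddProd_cast (T : ℤ) (l : ℕ) :
    ∀ s : ℕ, ((oddProd T l s : ℤ) : ℚ) = ∏ e ∈ range s, (2 * (T : ℚ) - 2 * l + 1 + 2 * e)
  | 0 => by simp [oddProd]
  | s + 1 => by
    rw [oddProd, Finset.prod_range_succ, Int.cast_mul, oddProd_cast T l s]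
    push_cast
    ring

/-- `(½)_n = (2n)!/(4^n n!)`. -/
theorem K0_eq (n : ℕ) : K0 n = ((2 * n).factorial : ℚ) / (4 ^ n * (n.factorial : ℚ)) := by
  induction n with
  | zero => simp [K0]
  | succ n ih =>
    have h : K0 (n + 1) = K0 n * ((1 : ℚ) / 2 + n) := Finset.prod_range_succ _ _
    rw [h, ih, show 2 * (n + 1) = (2 * n + 1) + 1 by ring, Nat.factorial_succ, Nat.factorial_succ (2 * n),
      Nat.factorial_succ n]
    have h1 : (n.factorial : ℚ) ≠ 0 := by positivity
    push_cast
    field_simp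
    ring

/-- Splitting fam-denom's numerator: `N(d) = (∏_{i<J} (d − J + ½ + i)) · ∏_{i<n} (d + ½ + i)`. -/
theorem Nnum_split (n J : ℕ) (d : ℚ) :
    Nnum n J d = (∏ i ∈ range J, (d - J + 1 / 2 + i)) * ∏ i ∈ range n, (d + 1 / 2 + i) := by
  unfold Nnum
  rw [Finset.prod_range_add]
  congr 1
  refine Finset.prod_congr rfl fun i _ => ?_
  push_cast
  ring

/-- Halving: `∏_{i<J} (d − J + ½ + i) = (∏_{e<J} (2d − 2J + 1 + 2e)) / 2^J`. -/
theorem prod_half_shift (J : ℕ) (d : ℚ) :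
    ∏ i ∈ range J, (d - J + 1 / 2 + i) = (∏ e ∈ range J, (2 * d - 2 * J + 1 + 2 * e)) / 2 ^ J := by
  rw [eq_div_iff (by positivity), ← Finset.card_range J, ← Finset.prod_const, Finset.card_range,
    ← Finset.prod_mul_distrib]
  refine Finset.prod_congr rfl fun i _ => ?_
  ring

/-- Halving: `∏_{i<n} (d + ½ + i) = (∏_{i<n} (2d + 2i + 1)) / 2^n`. -/
theorem prod_half (n : ℕ) (d : ℚ) :
    ∏ i ∈ range n, (d + 1 / 2 + i) = (∏ i ∈ range n, (2 * d + 2 * i + 1)) / 2 ^ n := by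
  rw [eq_div_iff (by positivity), ← Finset.card_range n, ← Finset.prod_const, Finset.card_range,
    ← Finset.prod_mul_distrib]
  refine Finset.prod_congr rfl fun i _ => ?_
  ring

/-! ### Closed forms of the punctured denominators and of the numerator at the poles -/

/-- `D2` at a non-negative integer `c` (no puncture): `∏_{e<2n}(c + e + 1) = (c + 2n)!/c!`. -/
theorem D2_nat (n c : ℕ) : D2 n c = ((c + 2 * n).factorial : ℚ) / (c.factorial : ℚ) := by
  unfold D2
  have hr : ∀ e ∈ range (2 * n), skip ((c : ℚ) + e + 1) = (((c + 1 + e : ℕ)) : ℚ) := by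
    intro e _
    rw [skip, if_neg (by positivity)]
    push_cast
    ring
  rw [Finset.prod_congr rfl hr, ← Nat.cast_prod, ← Nat.ascFactorial_eq_prod_range,
    eq_div_iff (by positivity), mul_comm, ← Nat.cast_mul, Nat.factorial_mul_ascFactorial,
    show c + 2 * n = c + 2 * n from rfl]

/-- `D1` at the simple pole `c` with `J = A + c + n` (puncture at `i = A`): `D1 = (−1)^A · A! · (c+n)!`. -/
theorem D1_nat (n c A : ℕ) :
    D1 n (A + c + n) c = (-1) ^ A * (A.factorial : ℚ) * ((c + n).factorial : ℚ) := by
  unfold D1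
  rw [show A + c + n + 1 = A + (c + n) + 1 by ring, ← prod_skip_window A (c + n)]
  refine Finset.prod_congr rfl fun i _ => ?_
  push_cast
  ring_nf

/-- `D1` at `−a` with `n = a + B`, `J = A + B` (puncture at `i = A`): `D1 = (−1)^A · A! · B!`. -/
theorem D1_neg (a A B : ℕ) :
    D1 (a + B) (A + B) (-(a : ℚ)) = (-1) ^ A * (A.factorial : ℚ) * (B.factorial : ℚ) := by
  unfold D1
  rw [← prod_skip_window A B]
  refine Finset.prod_congr rfl fun i _ => ?_
  push_cast
  ring_nf

/-- `D2` at `−(A+1)` with `2n = A + B + 1` (puncture at `e = A`): `D2 = (−1)^A · A! · B!`. -/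
theorem D2_neg (n A B : ℕ) (h : 2 * n = A + B + 1) :
    D2 n (-((A + 1 : ℕ) : ℚ)) = (-1) ^ A * (A.factorial : ℚ) * (B.factorial : ℚ) := by
  unfold D2
  rw [h, ← prod_skip_window A B]
  refine Finset.prod_congr rfl fun i _ => ?_
  push_cast
  ring_nf

/-- The numerator at the simple pole `c ≥ 0`:
`N(c) = oddProd(n+c, J+n, J) / 2^J · (2c+2n)! c! / ((2c)! (c+n)! 4^n)`... stated with the odd run. -/
theorem Nnum_nat (n J c : ℕ) :
    Nnum n J c = ((oddProd ((c + n : ℕ) : ℤ) (J + n) J : ℤ) : ℚ) / 2 ^ J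
      * (((2 * c + 2 * n).factorial : ℚ) * (c.factorial : ℚ)
          / (((2 * c).factorial : ℚ) * ((c + n).factorial : ℚ) * 2 ^ n) / 2 ^ n) := by
  rw [Nnum_split, prod_half_shift, prod_half, prod_odd_run, oddProd_cast]
  congr 2
  refine Finset.prod_congr rfl fun e _ => ?_
  push_cast
  ring

/-- The numerator at `−a`, `n = a + B`: `N(−a) = oddProd(B, J+n, J)/2^J · (−1)^a (2a−1)!! (2B−1)!! / 2^n`. -/
theorem Nnum_neg (a B J : ℕ) :
    Nnum (a + B) J (-(a : ℚ)) = ((oddProd (B : ℤ) (J + (a + B)) J : ℤ) : ℚ) / 2 ^ J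
      * ((-1) ^ a * (((2 * a).factorial : ℚ) / (2 ^ a * (a.factorial : ℚ)))
          * (((2 * B).factorial : ℚ) / (2 ^ B * (B.factorial : ℚ))) / 2 ^ (a + B)) := by
  rw [Nnum_split, prod_half_shift, prod_half, oddProd_cast]
  have hr : ∀ i ∈ range (a + B), (2 * (-(a : ℚ)) + 2 * i + 1) = (2 * (i : ℚ) - 2 * a + 1) := by
    intro i _; ring
  rw [Finset.prod_congr rfl hr, prod_odd_neg_run]
  congr 2
  refine Finset.prod_congr rfl fun e _ => ?_
  push_cast
  ring
/-! ### The tree's `qTerm` on the shifted box `(n, J, n, J+n, n)` -/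

/-- On the box `(n, J, n, J+n, n)` every summand of `QClosed` is of type A:
`qTerm(i) = 8(−1)^i C(J,i) · oddProd(J−i, J+n, J)/(2^J J!) · S(n, J−i)/4^(n+J−i)` (`i ≤ J`). -/
theorem qTerm_shift_eq (n J i : ℕ) (hi : i ≤ J) :
    qTerm n J n (J + n) n i
      = 8 * ((-1 : ℚ) ^ i * ((J.choose i : ℕ) : ℚ))
          * (((oddProd ((J - i : ℕ) : ℤ) (J + n) J : ℤ) : ℚ) / ((2 : ℚ) ^ J * (J.factorial : ℚ)))
          * superCatalan n (J - i) / (4 : ℚ) ^ (n + (J - i)) := by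
  unfold qTerm
  simp only [binomF_eq]
  have hs : J + n - n = J := by omega
  have ha : (n : ℤ) - ((J + n : ℕ) : ℤ) + (i : ℤ) ≤ 0 := by push_cast; omega
  rw [if_pos ha, hs]
  have hneg : -((n : ℤ) - ((J + n : ℕ) : ℤ) + (i : ℤ)) = ((J - i : ℕ) : ℤ) := by push_cast; omega
  rw [hneg, Int.toNat_natCast]
  unfold F1
  ring

/-! ### The two termwise identities -/

/-- **c-terms.** With `J = A + c + n` (so `i := J − n − c = A`):
`coef(c) · 8·C(2c,c)/4^c = qTerm(n, J, n, J+n, n; A)`. -/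
theorem cTerm_eq (n c A : ℕ) :
    coef n (A + c + n) c * (8 * ((Nat.choose (2 * c) c : ℕ) : ℚ) / 4 ^ c)
      = qTerm n (A + c + n) n (A + c + n + n) n A := by
  rw [qTerm_shift_eq n (A + c + n) A (by omega), show A + c + n - A = c + n by omega]
  unfold coef
  rw [K0_eq, Nnum_nat, D1_nat, D2_nat]
  unfold superCatalan
  -- binomial coefficients as factorial quotients
  have hC1 : (((A + c + n).choose A : ℕ) : ℚ) * (A.factorial : ℚ) * ((c + n).factorial : ℚ)
      = ((A + c + n).factorial : ℚ) := by
    have h := Nat.choose_mul_factorial_mul_factorial (show A ≤ A + c + n by omega)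
    rw [show A + c + n - A = c + n by omega] at h
    exact_mod_cast h
  have hC2 : (((2 * c).choose c : ℕ) : ℚ) * (c.factorial : ℚ) * (c.factorial : ℚ) = ((2 * c).factorial : ℚ) := by
    have h := Nat.choose_mul_factorial_mul_factorial (show c ≤ 2 * c by omega)
    rw [show 2 * c - c = c by omega] at h
    exact_mod_cast h
  rw [show 2 * (c + n) = 2 * c + 2 * n by ring, show n + (c + n) = c + 2 * n by ring, ← hC1, ← hC2]
  have h1 : (A.factorial : ℚ) ≠ 0 := by positivity
  have h2 : ((c + n).factorial : ℚ) ≠ 0 := by positivity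
  have h3 : (c.factorial : ℚ) ≠ 0 := by positivity
  have h4 : (n.factorial : ℚ) ≠ 0 := by positivity
  have h5 : ((c + 2 * n).factorial : ℚ) ≠ 0 := by positivity
  have h6 : (((A + c + n).choose A : ℕ) : ℚ) ≠ 0 := by
    have := Nat.choose_pos (show A ≤ A + c + n by omega); positivity
  have h7 : (((2 * c).choose c : ℕ) : ℚ) ≠ 0 := by
    have := Nat.choose_pos (show c ≤ 2 * c by omega); positivity
  have h4pow : ((4 : ℚ)) = 2 ^ 2 := by norm_num
  rw [h4pow, ← pow_mul, ← pow_mul, ← pow_mul]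
  rcases neg_one_pow_eq_or ℚ A with hA | hA <;> rw [hA] <;> field_simp <;> ring

/-- **a-terms.** With `a = A₂ + 1`, `n = a + B`, `J = A + B` (so `i := J − n + a = A`, `J − i = B = n − a`,
`2n − a = A₂ + 1 + 2B`): `−8 · coef(−a) · t_{a−1} = qTerm(n, J, n, J+n, n; A)` (`tB a` is fam-denom's `t_{a−1}`). -/
theorem aTerm_eq (A A₂ B : ℕ) :
    -(8 * (coef (A₂ + 1 + B) (A + B) (-((A₂ + 1 : ℕ) : ℚ)) * Denom.CatalanRayPClosed.tB (A₂ + 1)))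
      = qTerm (A₂ + 1 + B) (A + B) (A₂ + 1 + B) (A + B + (A₂ + 1 + B)) (A₂ + 1 + B) A := by
  rw [qTerm_shift_eq (A₂ + 1 + B) (A + B) A (by omega), show A + B - A = B by omega]
  unfold coef Denom.CatalanRayPClosed.tB
  rw [K0_eq, Nnum_neg (A₂ + 1) B (A + B), D1_neg (A₂ + 1) A B,
    D2_neg (A₂ + 1 + B) A₂ (A₂ + 1 + 2 * B) (by ring),
    show A₂ + 1 - 1 = A₂ by omega, show 2 * (A₂ + 1) - 1 = 2 * A₂ + 1 by omega]
  unfold superCatalan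
  have hC1 : (((A + B).choose A : ℕ) : ℚ) * (A.factorial : ℚ) * (B.factorial : ℚ) = ((A + B).factorial : ℚ) := by
    have h := Nat.choose_mul_factorial_mul_factorial (show A ≤ A + B by omega)
    rw [show A + B - A = B by omega] at h
    exact_mod_cast h
  rw [← hC1]
  -- factorial successors so that the atoms are A₂!, (2A₂+1)!, …
  rw [show 2 * (A₂ + 1) = (2 * A₂ + 1) + 1 by ring, Nat.factorial_succ (2 * A₂ + 1), Nat.factorial_succ A₂,
    show 2 * (A₂ + 1 + B) = (2 * A₂ + 2 * B + 1) + 1 by ring, show A₂ + 1 + B + B = A₂ + 1 + 2 * B by ring]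
  have h1 : (A.factorial : ℚ) ≠ 0 := by positivity
  have h2 : (B.factorial : ℚ) ≠ 0 := by positivity
  have h3 : (A₂.factorial : ℚ) ≠ 0 := by positivity
  have h4 : ((2 * A₂ + 1).factorial : ℚ) ≠ 0 := by positivity
  have h5 : ((A₂ + 1 + B).factorial : ℚ) ≠ 0 := by positivity
  have h6 : ((A₂ + 1 + 2 * B).factorial : ℚ) ≠ 0 := by positivity
  have h7 : (((A + B).choose A : ℕ) : ℚ) ≠ 0 := by
    have := Nat.choose_pos (show A ≤ A + B by omega); positivity
  have h4pow : ((4 : ℚ)) = 2 ^ 2 := by norm_num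
  rw [h4pow, ← pow_mul, ← pow_mul, ← pow_mul]
  rw [pow_succ (-1 : ℚ) A₂]
  push_cast
  rcases neg_one_pow_eq_or ℚ A with hA | hA <;> rcases neg_one_pow_eq_or ℚ A₂ with hA₂ | hA₂ <;>
    rw [hA, hA₂] <;> field_simp <;> ring
/-! ### The sum: `QxiClosed = QClosed` on the shifted box -/

/-- **(L4) as an identity of finite sums.**  For `n ≤ J` the `ξ`-coefficient of the slid 2-adic series,
`Σ_{c ≤ J−n} coef(c)·8C(2c,c)/4^c − 8 Σ_{a=1}^{n} coef(−a)·t_{a−1}` (the body of `CatalanTwoAdicSeries.QxiClosed n J`),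
equals the tree's closed form `QClosed n J n (J+n) n` of the `G`-coefficient — termwise, after the reindexing
`c ↦ i = J − n − c`, `a ↦ i = J − n + a`. -/
theorem qxiSum_eq_QClosed (n J : ℕ) (hJ : n ≤ J) :
    (∑ c ∈ range (J - n + 1), coef n J c * (8 * ((Nat.choose (2 * c) c : ℕ) : ℚ) / 4 ^ c))
        - 8 * ∑ a ∈ Icc 1 n, coef n J (-(a : ℚ)) * Denom.CatalanRayPClosed.tB a
      = QClosed n J n (J + n) n := by
  obtain ⟨M, rfl⟩ : ∃ M, J = M + n := ⟨J - n, by omega⟩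
  rw [show M + n - n + 1 = M + 1 by omega]
  -- the c-terms are the summands `i = 0, …, M` read backwards
  have hc : ∑ c ∈ range (M + 1), coef n (M + n) c * (8 * ((Nat.choose (2 * c) c : ℕ) : ℚ) / 4 ^ c)
      = ∑ i ∈ range (M + 1), qTerm n (M + n) n (M + n + n) n i := by
    conv_rhs => rw [← Finset.sum_flip]
    refine Finset.sum_congr rfl fun c hc => ?_
    rw [Finset.mem_range] at hc
    have h := cTerm_eq n c (M - c)
    rw [show M - c + c + n = M + n by omega] at h
    exact h
  -- the a-terms are the summands `i = M+1, …, M+n`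
  have ha : -(8 * ∑ a ∈ Icc 1 n, coef n (M + n) (-(a : ℚ)) * Denom.CatalanRayPClosed.tB a)
      = ∑ k ∈ range n, qTerm n (M + n) n (M + n + n) n (M + 1 + k) := by
    rw [← Finset.Ico_add_one_right_eq_Icc, Finset.sum_Ico_eq_sum_range, show n + 1 - 1 = n by omega, Finset.mul_sum,
      ← Finset.sum_neg_distrib]
    refine Finset.sum_congr rfl fun k hk => ?_
    rw [Finset.mem_range] at hk
    have h := aTerm_eq (M + 1 + k) k (n - 1 - k)
    rw [show k + 1 + (n - 1 - k) = n by omega, show M + 1 + k + (n - 1 - k) = M + n by omega] at h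
    rw [show 1 + k = k + 1 by ring, ← h]
  rw [sub_eq_add_neg, hc, ha, ← Finset.sum_range_add]
  unfold QClosed
  rw [qSum_eq_sum, show M + 1 + n = M + n + 1 by ring]

/-- **(L4) on the rays.**  For `j ≥ 1` and every `n`:
`Σ_{c ≤ jn−n} coef(c)·8C(2c,c)/4^c − 8 Σ_{a=1}^{n} coef(−a)·t_{a−1} = catalanQ n (jn) n ((j+1)n) n` — the body of
`CatalanTwoAdicSeries.QxiClosed n (jn)` equals the tree's `G`-coefficient closed form (`RayQxi j` of the endgame
file `CatalanTwoAdicRayClosed`). -/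
theorem qxiSum_ray_eq_catalanQ (j n : ℕ) (hj : 1 ≤ j) :
    (∑ c ∈ range (j * n - n + 1), coef n (j * n) c * (8 * ((Nat.choose (2 * c) c : ℕ) : ℚ) / 4 ^ c))
        - 8 * ∑ a ∈ Icc 1 n, coef n (j * n) (-(a : ℚ)) * Denom.CatalanRayPClosed.tB a
      = catalanQ n (j * n) n ((j + 1) * n) n := by
  have hn : n ≤ j * n := by nlinarith
  rw [qxiSum_eq_QClosed n (j * n) hn, show (j + 1) * n = j * n + n by ring,
    catalanQ_eq_QClosed n (j * n) n (j * n + n) n (by omega)]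

end Summit.KontsevichZagierPeriods.Zeta5Search.CatalanTwoAdicSeries
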